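import Literature.RepresentationTheory.Kovacevic2021.SU21SubquotientData
import Literature.RepresentationTheory.Kovacevic2021.SU21PrincipalSeriesCells
import HarnessLib

/-!
# Subquotients of Kovačević's principal series `V(c, 2t)` whose `K`-types form a product cell

Continuation of `…Kovacevic2021.SU21SubquotientData` (the subquotient datum `𝒟.subquotient N₁ N₂` of two Lie
submodules: `K`-types `sqSet`, live steps = live steps of `𝒟` inside `sqSet`, Casimir scalar unchanged) and
`…SU21PrincipalSeriesCells` (live staircase walks inside a product cell `{V_{1+p+q, 2t+3p−3q} : p ∈ I, q ∈ J}` of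
`V(c,2t)`) [Kovacevic2021, §3 Thm 3 and its proof, Remark 6].

**What is proved** (theorems only; no definitions, no named facts), for Lie submodules `N₁, N₂` of `V(c,2t)` whose
subquotient has, in cone coordinates, the `K`-types `{(p,q) : p ∈ I, q ∈ J}` (`I`, `J ⊆ ℤ_{≥0}` order-connected) with no
root of `a` between `p, p+1 ∈ I` and none of `b` between `q, q+1 ∈ J`:
* `subquotient_principalSeries_reach` — the subquotient datum is STRONGLY CONNECTED (any `K`-type reached from any
  other along its live arrows);
* `subquotient_principalSeries_casimirScalar` — on the cohomological parabola `4c + 2t²/3 = 0` its Casimir scalar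
  vanishes on every `K`-type;
* `subquotient_principalSeries_S_eq` — its `K`-type set is read off from a cone-coordinate description.
These are the three inputs of the recognition theorems of `SU21ModelRecognition`; the sequels
`SU21PrincipalSeriesCompositionFactors` (`V(0,0)`) and `SU21HolomorphicCompositionFactors` (`V(−3/2,±6)`) apply them
cell by cell [BorelWallach2000, VI 4.10 (10)].

## References

* D. Kovačević, *Unitary `(𝔤,K)` modules of `SU(2,1)`*, Acta Math. Spalatensia 1 (2021) 105–125
  (arXiv:1810.01752): §3 Thm 3 and its proof, Remark 3, Remark 6. [Kovacevic2021]
* A. Borel, N. Wallach (2000), VI 4.10 (10) p. 132. [BorelWallach2000]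
-/

noncomputable section

namespace Literature.RepresentationTheory.Kovacevic2021

-- Mathlib idiom (Mathlib/Algebra/Lie/OfAssociative.lean): commutator brackets on associative algebras; needed for
-- the `𝔤𝔩(3,ℂ)`-module structure on `𝒟.V` (Lie submodules of `V(c,2t)`), as in every file of this directory.
attribute [local instance 100] LieRing.ofAssociativeRing

namespace SU21Datum

open PrincipalSeries

section Generic

variable {c : ℂ} {t : ℤ} {N₁ N₂ : LieSubmodule ℂ (Matrix (Fin 3) (Fin 3) ℂ) (principalSeries c t).V} {I J : Set ℤ}

/-- **A subquotient of `V(c,2t)` whose `K`-types form a product cell with live internal `A`- and `B`-arrows is strongly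
connected** (the staircase walks of `SU21PrincipalSeriesCells.reach_of_cell` are live walks of the subquotient datum).
[cite: Kovacevic2021, §3 proof of Thm 3, Remark 6] -/
theorem subquotient_principalSeries_reach (hI : I.OrdConnected) (hJ : J.OrdConnected) (hI0 : ∀ p ∈ I, 0 ≤ p)
    (hJ0 : ∀ q ∈ J, 0 ≤ q)
    (hmem : ∀ p q : ℤ, 0 ≤ p → 0 ≤ q →
      (((1 + p + q, 2 * t + 3 * p - 3 * q) : ℤ × ℤ) ∈ (principalSeries c t).sqSet N₁ N₂ ↔ p ∈ I ∧ q ∈ J))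
    (hA : ∀ p ∈ I, p + 1 ∈ I → acoef c t p ≠ 0) (hB : ∀ q ∈ J, q + 1 ∈ J → bcoef c t q ≠ 0) :
    ∀ x ∈ ((principalSeries c t).subquotient N₁ N₂).S, ∀ y ∈ ((principalSeries c t).subquotient N₁ N₂).S,
      ((principalSeries c t).subquotient N₁ N₂).Reach x y := by
  rintro ⟨n, m⟩ hx ⟨n', m'⟩ hy
  obtain ⟨p₁, q₁, hp₁, hq₁, rfl, rfl⟩ := (mem_principalSeries_S_iff c t n m).1 hx.1
  obtain ⟨p₂, q₂, hp₂, hq₂, rfl, rfl⟩ := (mem_principalSeries_S_iff c t n' m').1 hy.1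
  obtain ⟨hpI, hqJ⟩ := (hmem p₁ q₁ hp₁ hq₁).1 hx
  obtain ⟨hpI', hqJ'⟩ := (hmem p₂ q₂ hp₂ hq₂).1 hy
  exact reach_of_cell (fun δ a b ha hb h => step_subquotient h ha hb) hI hJ hI0 hJ0
    (fun p hp q hq => (hmem p q (hI0 p hp) (hJ0 q hq)).2 ⟨hp, hq⟩) hA hB hpI hqJ hpI' hqJ'

/-- on the cohomological parabola every subquotient of `V(c,2t)` has Casimir scalar `0` on its `K`-types
[cite: Kovacevic2021, §3 Remark 3] [cite: BorelWallach2000, VI 4.10] -/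
theorem subquotient_principalSeries_casimirScalar (hpar : 4 * c + 2 * (t : ℂ) ^ 2 / 3 = 0) {n m : ℤ}
    (h : (n, m) ∈ ((principalSeries c t).subquotient N₁ N₂).S) :
    ((principalSeries c t).subquotient N₁ N₂).casimirScalar n m = 0 := by
  rw [subquotient_S] at h
  rw [subquotient_casimirScalar h]
  exact principalSeries_casimirScalar_eq_zero c t hpar h.1

/-- **Reading off the `K`-types of a subquotient of `V(c,2t)` in cone coordinates.** [cite: Kovacevic2021, §3 Remark 6] -/
theorem subquotient_principalSeries_S_eq {T : SU21Datum}
    (hmem : ∀ p q : ℤ, 0 ≤ p → 0 ≤ q →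
      (((1 + p + q, 2 * t + 3 * p - 3 * q) : ℤ × ℤ) ∈ (principalSeries c t).sqSet N₁ N₂ ↔ p ∈ I ∧ q ∈ J))
    (hT : ∀ n m : ℤ, (n, m) ∈ T.S ↔
      ∃ p q : ℤ, 0 ≤ p ∧ 0 ≤ q ∧ n = 1 + p + q ∧ m = 2 * t + 3 * p - 3 * q ∧ p ∈ I ∧ q ∈ J) :
    ((principalSeries c t).subquotient N₁ N₂).S = T.S := by
  ext ⟨n, m⟩
  rw [hT, subquotient_S]
  constructor
  · intro hx
    obtain ⟨p, q, hp, hq, rfl, rfl⟩ := (mem_principalSeries_S_iff c t n m).1 hx.1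
    exact ⟨p, q, hp, hq, rfl, rfl, (hmem p q hp hq).1 hx⟩
  · rintro ⟨p, q, hp, hq, rfl, rfl, hI, hJ⟩
    exact (hmem p q hp hq).2 ⟨hI, hJ⟩

end Generic

end SU21Datum

end Literature.RepresentationTheory.Kovacevic2021
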